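import Summits.QuantumFields.YangMills.Theorems.FluctuationComparisonRegPrIntLPersistenceOfRowsV4Chi
import HarnessLib

/-!
# PERS₁∘ AND TUBE∘ OF THE PERSISTENCE ORGAN, TEXTS VERBATIM, FROM THE PAIR OF ORGAN ROWS (UP∘, LOWB∘) ALONE — THE SOCKET-FREE JUNCTION AS TWO THEOREMS OF THE TREE
# (crux `FluctuationComparisonRegPrIntL`, stmt-QuantumFields-20520; ideator LINE g23-1 `Lines/stability_letters.lean` §5∕§7 ★★★ «PERS₁∘ AND TUBE∘ ⟸ {UP∘, LOWB∘} ALONE»)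

Cell `ym3-torus` (YM ladder rung R3 = continuum `SU(2)` Yang–Mills on the three-torus — a RUNG, NOT d = 4, NOT infinite volume, NOT a mass gap, NOT Clay).  Width seat
`ym-ust-20520-w4` (gen 19), filing the §2 theorem blocks of seat `ym-ust-20520-w5` (gen 18)'s withdrawn-unfiled junction `…PersistenceOfStabilityCans` (HOME
`ym-ust-20520-w5/g18/….SIGNATURE.w5g18.lean`, 2026-08-30T10:18Z) VERBATIM — credited — over seat `ym-ust-20520-w3` (gen 19)'s landed ✓`…PersistenceOfRowsV4Chi.upLow_of_stabilityCans`
(the bundle «⟨UP⟩ ∧ ⟨LOW on a sub-profile window⟩ ⟸ UP∘ ∧ LOWB∘», which made w5's own §1 copy redundant; LEAD word 10:46:15Z «a socket-free def-free junction with the conclusion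
«PERS₁∘-text ∧ TUBE∘-text ⟸ UP∘-text ∧ LOWB∘-text» is still a clean durable door — GO if its statements differ from mine token-wise»: they do — (C′)'s capstones take the 19936 rows
`(hT8) (hrows)`, these take the PAIR `hUL`).  `--supports stmt-QuantumFields-20520 --as helper`, count-neutral, definition-free, default heartbeats.

WHAT.  Hypothesis `hUL` = `def StabilityUpperCan` ∧ `def StabilityLowerWindowCan` bodies (`Lines/history_split.lean` :224∕:229 = `Lines/stability_letters.lean` :121∕:137) VERBATIM;
conclusions = ✓p766163's ∕ ✓p766221's conclusions (= `def OneLevelPersistenceIntCan` ∕ `def SectionTubeMassIntCan`, `Lines/section_lift.lean` :107∕:151) VERBATIM.  So EVERY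
edition of the two stability rows — v3 ✓p768257, χ∕rows ✓p769530 §2 `stabilityCans_of_thm1In8_selXsDataRows (hT8) (hrows)`, any later socket — yields PERS₁∘ ∧ TUBE∘ in one
line each, with no socket in this file.
* ★★★★ `oneLevelPersistenceIntCan_of_stabilityCans (hUL) : ⟨PERS₁∘⟩` — ✓`…PersistenceFromThm1.oneLevelPersistenceIntCan_of_heightwiseBounds` ∘ ✓`upLow_of_stabilityCans` at `t c b₀ := c·b₀`.
* ★★★★ `sectionTubeMassIntCan_of_stabilityCans (hUL) : ⟨TUBE∘⟩` — ✓`…TubeFromThm1.sectionTubeMassIntCan_of_heightwiseBounds` ∘ ✓`upLow_of_stabilityCans` at `t c b₀ := 2·b₀`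
  (`2·θBal(b₀) = θBal(2b₀)`, lit ✓`θBal_mul`).

HONEST SCOPE.  A junction (bookkeeping over three landed doors); UP∘, LOWB∘ are HYPOTHESES here (their editions of record are CONDITIONAL on the 19936 rows {`hT8`, `hrows`});
nothing of [Balaban1985UV3] Theorem 1, PERS₁∘, TUBE∘, LFR♯ᶜ∘, S2β, `FluctuationComparisonRegPrIntL` (20520) or the rung is proved; no summit is proved by a helper; rung R3 =
SU(2) YM₃ on T³ — NOT d = 4, NOT infinite volume, NOT a mass gap, NOT Clay.  Sorry-free, axioms standard.

References: T. Bałaban, CMP **102** (1985) 255–275 [Balaban1985UV3] ((4)–(7) pp.256–257, Thm 1 p.257, (41) p.266, (47) p.267); T. Bałaban, CMP **98** (1985) 17–51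
[Balaban1985Averaging] ((10) p.19); T. Bałaban, CMP **102** (1985) 277–309 [Balaban1985Variational] (Thm 1 p.279).
-/

set_option autoImplicit false

noncomputable section

namespace Summit.QuantumFields.YangMills.Theorems.FluctuationComparisonRegPrIntLPersistenceOfStabilityCans

open MeasureTheory
open Literature.MathematicalPhysics.QuantumFieldTheory.Balaban1983to89
open Literature.MathematicalPhysics.QuantumFieldTheory.Balaban1983to89.T3ContinuumYM3Torus
open Literature.MathematicalPhysics.QuantumFieldTheory.Balaban1983to89.T3UnitLawDensityEML (ℰp)
open Literature.MathematicalPhysics.QuantumFieldTheory.Balaban1983to89.T3UnitScaleTilt (θBal gibbsK)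
open Literature.MathematicalPhysics.QuantumFieldTheory.Balaban1983to89.T3TiltDescent (heightDensity descendTo)
open Literature.MathematicalPhysics.QuantumFieldTheory.Balaban1983to89.T3HeightwiseDensityBounds
open Literature.MathematicalPhysics.QuantumFieldTheory.Balaban1983to89.Missing (partitionFn)
open Summit.QuantumFields.YangMills.Theorems.FluctuationComparisonRegPrIntLPersistenceOfRowsV4Chi (upLow_of_stabilityCans)

/-! ## §2 PERS₁∘ and TUBE∘, texts verbatim, from the pair (UP∘, LOWB∘) alone -/

/-- ★★★★ **PERS₁∘ — ONE-LEVEL PERSISTENCE OF SMALLNESS UNDER THE DESCENDED GIBBS MEASURES (the organ row `OneLevelPersistenceIntCan`, text = ✓p766163's conclusion VERBATIM) FROM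
THE PAIR (UP∘, LOWB∘) ALONE**: seat w3-20520 g18's ✓`oneLevelPersistenceIntCan_of_heightwiseBounds` fed by `upLow_of_stabilityCans` at the profile map `t c b₀ := c·b₀`.  The
ideator's junction (`Lines/stability_letters.lean` §5) as a theorem of the tree. [cite: Balaban1985UV3, (4)–(7) pp.256–257, Thm 1 p.257, (41) p.266, (47) p.267; Balaban1985Variational, Thm 1 p.279] -/
theorem oneLevelPersistenceIntCan_of_stabilityCans
    (hUL : (∀ (L : ℕ), ∃ γ₁ : ℝ, 0 < γ₁ ∧ ∀ (F : T3Family) (γ : ℝ), F.L = L → 0 < γ → γ ≤ γ₁ → HeightwiseUpperBound F γ) ∧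
      (∀ (L : ℕ), ∃ bB pB : ℝ, ∀ (b₀ p₀ : ℝ), bB ≤ b₀ → pB ≤ p₀ →
        ∃ γ₁ : ℝ, 0 < γ₁ ∧ ∀ (F : T3Family) (γ : ℝ), F.L = L → 0 < γ → γ ≤ γ₁ →
          ∀ (n : ℕ), ∃ cl : ℝ, 0 < cl ∧ ∀ (K : ℕ) (hK : n ≤ K),
            ∀ᵐ V ∂(fieldMeasure (F.P n) 0 (Matrix.specialUnitaryGroup (Fin 2) ℂ)),
              PlaqSmall (θBal F.L γ b₀ p₀ n) V →
                cl ≤ (partitionFn (G := Matrix.specialUnitaryGroup (Fin 2) ℂ) (F.P K) ((F.scheme ℰp γ).β K))⁻¹ *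
                  heightDensity F γ hK Set.univ V)) :
    ∀ (L : ℕ), ∃ c₀ : ℝ, 0 < c₀ ∧ c₀ ≤ 1 ∧ ∀ (c : ℝ), 0 < c → c ≤ c₀ → ∃ pS : ℝ, ∀ (b₀ p₀ : ℝ), 0 < b₀ → pS ≤ p₀ → 0 < p₀ →
      ∃ γ₁ : ℝ, 0 < γ₁ ∧ ∀ (F : T3Family) (γ : ℝ), F.L = L → 0 < γ → γ ≤ γ₁ →
        ∀ (J : ℕ), ∃ q : ℝ, 0 < q ∧ ∀ (K : ℕ) (hJK : J + 1 ≤ K)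
          (B : Set (GaugeField (F.P J) 0 (Matrix.specialUnitaryGroup (Fin 2) ℂ))), MeasurableSet B →
            B ⊆ {U | PlaqSmall (θBal F.L γ (c * b₀) p₀ J) U} →
            ENNReal.ofReal q * gibbsK F ℰp γ K (descendTo F ℰp J K ((Nat.le_succ J).trans hJK) ⁻¹' B) ≤
              gibbsK F ℰp γ K (descendTo F ℰp J K ((Nat.le_succ J).trans hJK) ⁻¹' B ∩
                descendTo F ℰp (J + 1) K hJK ⁻¹' {V | PlaqSmall (θBal F.L γ (c * b₀) p₀ (J + 1)) V}) :=
  FluctuationComparisonRegPrIntLPersistenceFromThm1.oneLevelPersistenceIntCan_of_heightwiseBounds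
    (upLow_of_stabilityCans hUL (fun c b₀ => c * b₀) fun _ _ hc hb₀ => mul_pos hc hb₀)

/-- ★★★★ **TUBE∘ — THE SECTION-TUBE MASS INEQUALITY (the organ row `SectionTubeMassIntCan`, text = ✓p766221's conclusion VERBATIM) FROM THE PAIR (UP∘, LOWB∘) ALONE**: seat
w4-20520's ✓`sectionTubeMassIntCan_of_heightwiseBounds` fed by `upLow_of_stabilityCans` at the profile map `t c b₀ := 2·b₀` (`2·θBal(b₀) = θBal(2b₀)`, lit ✓`θBal_mul`).  The
ideator's junction (`Lines/stability_letters.lean` §7) as a theorem of the tree. [cite: Balaban1985UV3, (4)–(7) pp.256–257, Thm 1 p.257, (41) p.266, (47) p.267; Balaban1985Averaging, (10) p.19] -/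
theorem sectionTubeMassIntCan_of_stabilityCans
    (hUL : (∀ (L : ℕ), ∃ γ₁ : ℝ, 0 < γ₁ ∧ ∀ (F : T3Family) (γ : ℝ), F.L = L → 0 < γ → γ ≤ γ₁ → HeightwiseUpperBound F γ) ∧
      (∀ (L : ℕ), ∃ bB pB : ℝ, ∀ (b₀ p₀ : ℝ), bB ≤ b₀ → pB ≤ p₀ →
        ∃ γ₁ : ℝ, 0 < γ₁ ∧ ∀ (F : T3Family) (γ : ℝ), F.L = L → 0 < γ → γ ≤ γ₁ →
          ∀ (n : ℕ), ∃ cl : ℝ, 0 < cl ∧ ∀ (K : ℕ) (hK : n ≤ K),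
            ∀ᵐ V ∂(fieldMeasure (F.P n) 0 (Matrix.specialUnitaryGroup (Fin 2) ℂ)),
              PlaqSmall (θBal F.L γ b₀ p₀ n) V →
                cl ≤ (partitionFn (G := Matrix.specialUnitaryGroup (Fin 2) ℂ) (F.P K) ((F.scheme ℰp γ).β K))⁻¹ *
                  heightDensity F γ hK Set.univ V)) :
    ∀ (L : ℕ), ∃ c₀ : ℝ, 0 < c₀ ∧ c₀ ≤ 1 ∧ ∀ (c : ℝ), 0 < c → c ≤ c₀ → ∃ pS : ℝ, ∀ (b₀ p₀ : ℝ), 0 < b₀ → pS ≤ p₀ → 0 < p₀ →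
      ∃ γ₁ : ℝ, 0 < γ₁ ∧ ∀ (F : T3Family) (γ : ℝ), F.L = L → 0 < γ → γ ≤ γ₁ →
        ∀ (J : ℕ) (r : ℝ), 0 < r →
          ∀ σ : GaugeField (F.P J) 0 (Matrix.specialUnitaryGroup (Fin 2) ℂ) → GaugeField (F.P (J + 1)) 0 (Matrix.specialUnitaryGroup (Fin 2) ℂ), Measurable σ →
            (∀ U : GaugeField (F.P J) 0 (Matrix.specialUnitaryGroup (Fin 2) ℂ), PlaqSmall (θBal F.L γ (c * b₀) p₀ J) U →
              descendTo F ℰp J (J + 1) (Nat.le_succ J) (σ U) = U ∧ PlaqSmall (θBal F.L γ b₀ p₀ (J + 1)) (σ U)) →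
            ∃ q : ℝ, 0 < q ∧ ∀ (K : ℕ) (hJK : J + 1 ≤ K)
              (B : Set (GaugeField (F.P J) 0 (Matrix.specialUnitaryGroup (Fin 2) ℂ))), MeasurableSet B →
                B ⊆ {U | PlaqSmall (θBal F.L γ (c * b₀) p₀ J) U} →
                ENNReal.ofReal q * gibbsK F ℰp γ K (descendTo F ℰp J K ((Nat.le_succ J).trans hJK) ⁻¹' B) ≤
                  gibbsK F ℰp γ K (descendTo F ℰp J K ((Nat.le_succ J).trans hJK) ⁻¹' B ∩
                    {V | ∀ b : PBond (F.P (J + 1)) 0,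
                      dist1 ((σ (descendTo F ℰp J K ((Nat.le_succ J).trans hJK) V) b)⁻¹ *
                        descendTo F ℰp (J + 1) K hJK V b) < r}) := by
  have h := upLow_of_stabilityCans hUL (fun _ b₀ => 2 * b₀) fun _ _ _ hb₀ => by positivity
  refine FluctuationComparisonRegPrIntLTubeFromThm1.sectionTubeMassIntCan_of_heightwiseBounds fun L => ?_
  obtain ⟨c₀, hc₀, hc₀1, hc⟩ := h L
  refine ⟨c₀, hc₀, hc₀1, fun c hcpos hcle => ?_⟩
  obtain ⟨pS, hpS⟩ := hc c hcpos hcle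
  refine ⟨pS, fun b₀ p₀ hb₀ hpS' hp₀ => ?_⟩
  obtain ⟨γ₁, hγ₁, hF⟩ := hpS b₀ p₀ hb₀ hpS' hp₀
  refine ⟨γ₁, hγ₁, fun F γ hFL hγ hγle => ?_⟩
  obtain ⟨hup, hlow⟩ := hF F γ hFL hγ hγle
  refine ⟨hup, fun J => ?_⟩
  obtain ⟨cl, hcl, hK⟩ := hlow J
  refine ⟨cl, hcl, fun K hJK => ?_⟩
  filter_upwards [hK K hJK] with V hV hsmall
  refine hV ?_
  rw [T3InteriorExcision.θBal_mul]
  exact hsmall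

end Summit.QuantumFields.YangMills.Theorems.FluctuationComparisonRegPrIntLPersistenceOfStabilityCans

end
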